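import Literature.AlgebraicGeometry.Motives.SeesawGrauertAffineCech
import HarnessLib

/-!
# The basic-open form of the Grothendieck complex of `𝒪(D)` in degree `0`
# (`grothendieckComplex_sectionsOver_basicOpen`) from the pseudo-coherence of the Čech complex
# (Görtz–Wedhorn II, Cor. 23.135 / Cor. 23.137)

Sibling proofs file of `Motives/SeesawGrauertGluing`, whose named fact
`grothendieckComplex_sectionsOver_basicOpen` is Görtz–Wedhorn II, Cor. 23.137 in degree `0` for
`𝒪(D)` on `pr_T : X ×_K T → T` at the `A`-algebras `A_a = Γ(T_a, 𝒪_T)` (non-empty basic opens of an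
affine open `V = Spec A ∋ t₀`) and `κ(t)`, `t ∈ V` (over a general base: Cor. 23.135 with
Rem. 23.134 and Prop. 22.53, p. 480; the fibre compatibility is (23.28.5)–(23.28.6), p. 482). That
fact is a decomposition child of `grothendieckComplex_sectionsOver` (`Motives/SeesawGrauert`,
glue `grothendieckComplex_sectionsOver_of_basicOpen`), and it cannot be discharged inside
`Motives/SeesawGrauertGluing` itself: every file of its in-tree proof imports that module. This
file records that proof, which the directory already contains as a chain of PROVED implications,
as single theorems:

* `grothendieckComplex_sectionsOver_basicOpen_of_perfect` — PROVED: the fact follows from the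
  perfectness of the ordered Čech complex `Č•(𝔚, 𝒪(D)|_{pr_T⁻¹V})` over an affine open of the base
  (`cechComplex_perfect`, `Motives/GrothendieckComplexCech`; Cor. 23.135): the affine form (Cor.
  23.137 at `B = A` and `B = κ(t)`; a proved statement, not a named fact) is
  `grothendieckComplex_sectionsOver_affine_of_perfect` (`Motives/SeesawGrauertAffineCech`: Mumford's
  Lemma 2 and the matrix of `d⁰_P`), and the passage to the basic opens `T_a ⊆ V` is the flat base
  change `A → A_a` (`grothendieckComplex_sectionsOver_basicOpen_of_affine`,
  `Motives/SeesawGrauertLocalization`);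
* `grothendieckComplex_sectionsOver_basicOpen_of_pseudoCoherent_general` — PROVED: the basic-open
  form follows from the single deep leaf of this directory,
  `cechComplex_pseudoCoherent_general` (`Motives/GrothendieckComplexSectionAlongCech`: the Čech
  complex of `𝒪(D)` over an affine open of the base is pseudo-coherent — Thm. 23.133 / Cor. 23.135,
  the finiteness theorem for the coherent cohomology of proper morphisms, itself reduced to the
  noetherian case by `cechComplex_pseudoCoherent_general_of_finite_cohomology`,
  `Motives/CechComplexPseudoCoherentDescent`), through `cechComplex_perfect_of_general`
  (Steps (II)–(III) of the printed proof of Thm. 23.133, proved for complexes of modules). This is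
  the same leaf on which `Motives/AbelianVarietyTheoremOfCubeProofs` rests the parent
  (`grothendieckComplex_sectionsOver_of_pseudoCoherent_general`) and the Theorem of the Cube.

What is NOT here: the discharge `grothendieckComplex_sectionsOver_basicOpen_holds`. It is the
one-line `grothendieckComplex_sectionsOver_basicOpen_of_pseudoCoherent_general
cechComplex_pseudoCoherent_general_holds`, to be APPENDED TO THIS FILE the moment
`cechComplex_pseudoCoherent_general_holds` lands; no further named fact and no further
decomposition of the child is needed or admissible for it (D-0026): the child is blocked upstream
on that leaf, nothing else. Mathlib (pin) has no coherent cohomology of proper morphisms and no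
cohomology and base change; nothing searched beyond the tree declarations named above
(`lean search grothendieckComplex_sectionsOver_basicOpen`, `cechComplex_pseudoCoherent_general_holds`
— the latter absent).

## References

* U. Görtz, T. Wedhorn, *Algebraic Geometry II: Cohomology of Schemes*, Springer Spektrum (2023),
  doi:10.1007/978-3-658-43031-3: Thm. 23.133 and its proof, Steps (I)–(IV), pp. 478–479;
  Rem. 23.134, Cor. 23.135, Cor. 23.137, p. 480; (23.28.5)–(23.28.6), p. 482; Thm. 23.140 (3),
  p. 483 (read via the held copy, pp. 478–483). [GortzWedhorn2023]
* D. Mumford, *Abelian Varieties*, TIFR Studies in Mathematics 5 (1970), §5 (the Grothendieck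
  complex, "functorial in the `A`-algebra `B`"). [MumfordAV1970]
-/

universe u

namespace Literature.AlgebraicGeometry.Motives

/-- **The basic-open form of the Grothendieck complex of `𝒪(D)` in degree `0` from the perfectness
of the Čech complex** (Görtz–Wedhorn II, Cor. 23.135 / Cor. 23.137 at the flat `A`-algebras `A_a`
and at `κ(t)`, pp. 480–482): the affine form over `V = Spec A`
(`grothendieckComplex_sectionsOver_affine_of_perfect`), then localization to the basic opens
(`grothendieckComplex_sectionsOver_basicOpen_of_affine`).
[cite: GortzWedhorn2023, Cor. 23.135 and Cor. 23.137 (p. 480) with (23.28.5)–(23.28.6) (p. 482)] -/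
theorem grothendieckComplex_sectionsOver_basicOpen_of_perfect (h : cechComplex_perfect.{u}) :
    grothendieckComplex_sectionsOver_basicOpen.{u} :=
  grothendieckComplex_sectionsOver_basicOpen_of_affine
    (grothendieckComplex_sectionsOver_affine_of_perfect h)

/-- **The basic-open form of the Grothendieck complex of `𝒪(D)` in degree `0`
(`grothendieckComplex_sectionsOver_basicOpen`, `Motives/SeesawGrauertGluing`) from the
pseudo-coherence of the Čech complex with the binders of Cor. 23.135** — the single deep leaf
`cechComplex_pseudoCoherent_general` of this directory (Görtz–Wedhorn II, Thm. 23.133: finiteness of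
the coherent cohomology of proper morphisms): `cechComplex_perfect_of_general`, then
`grothendieckComplex_sectionsOver_basicOpen_of_perfect`. The discharge
`grothendieckComplex_sectionsOver_basicOpen_holds` is this theorem applied to
`cechComplex_pseudoCoherent_general_holds` once Thm. 23.133 lands.
[cite: GortzWedhorn2023, Thm. 23.133, Cor. 23.135 and Cor. 23.137 (pp. 478–480)] -/
theorem grothendieckComplex_sectionsOver_basicOpen_of_pseudoCoherent_general
    (h : cechComplex_pseudoCoherent_general.{u}) : grothendieckComplex_sectionsOver_basicOpen.{u} :=
  grothendieckComplex_sectionsOver_basicOpen_of_perfect (cechComplex_perfect_of_general h)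

end Literature.AlgebraicGeometry.Motives
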